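import Literature.NumberTheory.Sieve.PolymathMkEpsJ
import HarnessLib

/-!
# Polymath 8b §6, Lemma 6.1 for the `ε`-enlarged functional: weighted Cauchy–Schwarz on the fibres of `J_{i,1-ε}`

Topic `Literature/NumberTheory/Sieve`; first support file of the discharge of the named fact
`Literature.Barriers.Parity.Polymath2014_epsFunctional_le` (Polymath 8b, Proposition 6.5:
`M_{k,ε} ≤ (k/(k-1)) log(2k-1)`), stated on the tree's `polymathFunctional k ε F` /
`IsPolymathTestFunction k ε F` (`PolymathBoundedGaps.lean`).

This file is the analogue, for the functional `(∑ᵢ J_{i,1-ε}(F))/I(F)` of Theorem 3.12, of the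
Cauchy–Schwarz device of Polymath 8b Lemma 6.1 (D. H. J. Polymath, *Variants of the Selberg sieve, and
bounded intervals containing many primes*, Res. Math. Sci. 1:12 (2014) = arXiv:1407.4897, §6, p. 24):
if measurable weights `wᵢ > 0` satisfy the fibre budget `∫₀^{1+ε-∑ⱼsⱼ} du / wᵢ(s with sᵢ := u) ≤ 1` for every
outer point `s ≥ 0` with `∑_{j ≠ i} s_j ≤ 1 - ε`, then `J_{i,1-ε}(F) ≤ ∫_{Eᵢ} wᵢ F²` with
`Eᵢ = {t : tᵢ > 0, ∑_{j≠i} tⱼ ≤ 1-ε}` (`MkEps.ofReal_polymathJ_le`), and consequently a POINTWISE bound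
`∑ᵢ 1_{Eᵢ} wᵢ ≤ M` on the enlarged simplex gives `(∑ᵢ J_{i,1-ε}(F))/I(F) ≤ M`
(`polymathFunctional_le_of_weights`).  The printed Lemma 6.1 is the case `ε = 0` phrased with
`Gᵢ = 1/wᵢ`; for `ε > 0` the regions `Eᵢ` genuinely differ with `i`, which is why the pointwise hypothesis
carries the indicators `1_{Eᵢ}` (see `PolymathMkEpsUpperBound.lean` for why this matters in Proposition 6.5).

Implementation: the fibre inequality is proved in `ℝ≥0∞` (Hölder with exponents `2, 2`,
`ENNReal.lintegral_mul_le_Lp_mul_Lq`, as in `MaynardTao.ofReal_sq_integral_le`) so that no fibrewise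
integrability is needed; the fibres are split off with `polymathJ_succ_eq` (`PolymathMkEpsJ.lean`) and
reassembled by Tonelli through the volume-preserving `MeasurableEquiv.piFinSuccAbove`.

## References
* [Polymath8b2014] D. H. J. Polymath, *Variants of the Selberg sieve, and bounded intervals containing many
  primes*, Res. Math. Sci. 1 (2014), Art. 12 = arXiv:1407.4897, Lemma 6.1 and Proposition 6.5 (p. 24).
-/

noncomputable section

open MeasureTheory Set Filter Finset
open scoped ENNReal BigOperators

namespace Literature.NumberTheory.Sieve

namespace MkEps

/-! ### The fibre inequality -/

/-- **Weighted Cauchy–Schwarz on a half-line fibre** (the one-dimensional step of Polymath 8b Lemma 6.1,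
general weight): if `g` vanishes at every `u > L` (with `u > 0`) and `w > 0` wherever `g ≠ 0` on `(0, ∞)`,
then `(∫_{u>0} g)² ≤ (∫_{(0,L]} 1/w) · ∫_{u>0} w g²`, in `ℝ≥0∞` (no integrability needed).
[cite: Polymath8b2014, Lemma 6.1 (proof)] -/
theorem ofReal_sq_setIntegral_Ioi_le {g w : ℝ → ℝ} (hg : Measurable g) (hw : Measurable w) {L : ℝ}
    (hsupp : ∀ u, 0 < u → g u ≠ 0 → u ≤ L ∧ 0 < w u) :
    ENNReal.ofReal ((∫ u in Ioi (0:ℝ), g u) ^ 2) ≤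
      (∫⁻ u in Ioc (0:ℝ) L, ENNReal.ofReal (w u)⁻¹) *
        ∫⁻ u in Ioi (0:ℝ), ENNReal.ofReal (w u * g u ^ 2) := by
  obtain ⟨f₁, hf₁⟩ : ∃ f₁ : ℝ → ℝ≥0∞,
      f₁ = fun u => ENNReal.ofReal (|g u| * Real.sqrt (w u)) := ⟨_, rfl⟩
  obtain ⟨f₂, hf₂⟩ : ∃ f₂ : ℝ → ℝ≥0∞,
      f₂ = (Ioc 0 L).indicator fun u => ENNReal.ofReal ((Real.sqrt (w u))⁻¹) := ⟨_, rfl⟩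
  have hf₁m : Measurable f₁ := by
    rw [hf₁]
    exact ((continuous_abs.measurable.comp hg).mul
      (Real.continuous_sqrt.measurable.comp hw)).ennreal_ofReal
  have hf₂m : Measurable f₂ := by
    rw [hf₂]
    exact ((Real.continuous_sqrt.measurable.comp hw).inv.ennreal_ofReal).indicator
      measurableSet_Ioc
  -- Step 1: pass to `‖·‖ₑ`
  have step1 : ENNReal.ofReal ((∫ u in Ioi (0:ℝ), g u) ^ 2) ≤
      (∫⁻ u in Ioi (0:ℝ), ‖g u‖ₑ) ^ 2 := by
    rw [← sq_abs, ENNReal.ofReal_pow (abs_nonneg _), ← Real.enorm_eq_ofReal_abs]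
    gcongr
    exact enorm_integral_le_lintegral_enorm _
  -- Step 2: pointwise factorisation `|g| = (|g| √w) · (√w)⁻¹` on `(0, ∞)`
  have step2 : ∫⁻ u in Ioi (0:ℝ), ‖g u‖ₑ ≤ ∫⁻ u in Ioi (0:ℝ), (f₁ * f₂) u := by
    refine setLIntegral_mono' measurableSet_Ioi fun u hu => ?_
    by_cases hg0 : g u = 0
    · simp [hg0]
    obtain ⟨huL, hwu⟩ := hsupp u hu hg0
    have huS : u ∈ Ioc 0 L := ⟨hu, huL⟩
    have hsq : 0 < Real.sqrt (w u) := Real.sqrt_pos.2 hwu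
    simp only [hf₁, hf₂, Pi.mul_apply, indicator_of_mem huS]
    rw [← ENNReal.ofReal_mul (by positivity), Real.enorm_eq_ofReal_abs,
      mul_inv_cancel_right₀ hsq.ne']
  -- Step 3: Hölder with exponents `2, 2`
  have step3 : ∫⁻ u in Ioi (0:ℝ), (f₁ * f₂) u ≤
      (∫⁻ u in Ioi (0:ℝ), f₁ u ^ (2:ℝ)) ^ (1 / 2 : ℝ) *
        (∫⁻ u in Ioi (0:ℝ), f₂ u ^ (2:ℝ)) ^ (1 / 2 : ℝ) :=
    ENNReal.lintegral_mul_le_Lp_mul_Lq _ Real.HolderConjugate.two_two hf₁m.aemeasurable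
      hf₂m.aemeasurable
  -- Step 4: the first factor is `∫ w g²`
  have step4 : ∫⁻ u in Ioi (0:ℝ), f₁ u ^ (2:ℝ) ≤
      ∫⁻ u in Ioi (0:ℝ), ENNReal.ofReal (w u * g u ^ 2) := by
    refine setLIntegral_mono' measurableSet_Ioi fun u hu => ?_
    rw [ENNReal.rpow_two]
    by_cases hg0 : g u = 0
    · simp [hf₁, hg0]
    obtain ⟨-, hwu⟩ := hsupp u hu hg0
    simp only [hf₁]
    rw [← ENNReal.ofReal_pow (by positivity), mul_pow, Real.sq_sqrt hwu.le, sq_abs, mul_comm]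
  -- Step 5: the second factor is at most `∫_{(0,L]} 1/w`
  have step5 : ∫⁻ u in Ioi (0:ℝ), f₂ u ^ (2:ℝ) ≤ ∫⁻ u in Ioc (0:ℝ) L, ENNReal.ofReal (w u)⁻¹ := by
    calc ∫⁻ u in Ioi (0:ℝ), f₂ u ^ (2:ℝ)
        ≤ ∫⁻ u, f₂ u ^ (2:ℝ) := setLIntegral_le_lintegral _ _
      _ ≤ ∫⁻ u, (Ioc 0 L).indicator (fun u => ENNReal.ofReal (w u)⁻¹) u := by
        refine lintegral_mono fun u => ?_
        rw [ENNReal.rpow_two]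
        by_cases huS : u ∈ Ioc 0 L
        · simp only [hf₂, indicator_of_mem huS]
          rw [← ENNReal.ofReal_pow (inv_nonneg.2 (Real.sqrt_nonneg _)), inv_pow]
          rcases le_or_gt 0 (w u) with hw0 | hw0
          · rw [Real.sq_sqrt hw0]
          · have h1 : Real.sqrt (w u) = 0 := Real.sqrt_eq_zero'.2 hw0.le
            simp [h1]
        · simp [hf₂, huS]
      _ = ∫⁻ u in Ioc 0 L, ENNReal.ofReal (w u)⁻¹ := lintegral_indicator measurableSet_Ioc _
  -- combine
  have hhalf : ∀ x : ℝ≥0∞, (x ^ (1 / 2 : ℝ)) ^ 2 = x := fun x => by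
    rw [← ENNReal.rpow_two, ← ENNReal.rpow_mul]; norm_num
  calc ENNReal.ofReal ((∫ u in Ioi (0:ℝ), g u) ^ 2)
      ≤ (∫⁻ u in Ioi (0:ℝ), ‖g u‖ₑ) ^ 2 := step1
    _ ≤ (∫⁻ u in Ioi (0:ℝ), (f₁ * f₂) u) ^ 2 := by gcongr
    _ ≤ ((∫⁻ u in Ioi (0:ℝ), f₁ u ^ (2:ℝ)) ^ (1 / 2 : ℝ) *
          (∫⁻ u in Ioi (0:ℝ), f₂ u ^ (2:ℝ)) ^ (1 / 2 : ℝ)) ^ 2 := by gcongr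
    _ = (∫⁻ u in Ioi (0:ℝ), f₁ u ^ (2:ℝ)) * ∫⁻ u in Ioi (0:ℝ), f₂ u ^ (2:ℝ) := by
          rw [mul_pow, hhalf, hhalf]
    _ ≤ (∫⁻ u in Ioi (0:ℝ), ENNReal.ofReal (w u * g u ^ 2)) *
          ∫⁻ u in Ioc (0:ℝ) L, ENNReal.ofReal (w u)⁻¹ := mul_le_mul' step4 step5
    _ = _ := mul_comm _ _

/-! ### From the fibres to `J_{i,1-ε}` -/

/-- The region where the `m`-th marginal is counted in `J_{m,1-ε}`: `t_m > 0` (the fibre variable) and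
`∑_{j ≠ m} t_j ≤ 1 - ε` (the truncated outer simplex of Theorem 3.12). [cite: Polymath8b2014, Theorem 3.12, definition of J_{i,1-ε}] -/
theorem measurableSet_active {k : ℕ} (m : Fin k) (r : ℝ) :
    MeasurableSet {t : Fin k → ℝ | 0 < t m ∧ ∑ j ∈ univ.erase m, t j ≤ r} := by
  refine (measurableSet_lt measurable_const (measurable_pi_apply m)).inter ?_
  exact measurableSet_le (continuous_finsetSum _ fun j _ => continuous_apply j).measurable
    measurable_const

/-- **Lemma 6.1 for `J_{m,1-ε}`, general weight.** Let `F` be a test function of Theorem 3.12 on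
`(1+ε)·R_{n+1}` and `w` a measurable weight, positive wherever `F ≠ 0`, `t_m > 0` and
`∑_{j≠m} t_j ≤ 1-ε`, whose fibres satisfy the budget `∫_{(0, 1+ε-∑s]} du / w(s with s_m := u) ≤ 1` for every
outer point `s ≥ 0` with `∑ s ≤ 1 - ε`.  Then `J_{m,1-ε}(F) ≤ ∫_{t_m > 0, ∑_{j≠m} t_j ≤ 1-ε} w F²` (in `ℝ≥0∞`).
Proof: slice with `polymathJ_succ_eq`, apply `ofReal_sq_setIntegral_Ioi_le` on each fibre, reassemble by
Tonelli. [cite: Polymath8b2014, Lemma 6.1 and Proposition 6.5 (proof)] -/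
theorem ofReal_polymathJ_le {n : ℕ} (m : Fin (n + 1)) {ε : ℝ} {F : (Fin (n + 1) → ℝ) → ℝ}
    (hF : IsPolymathTestFunction (n + 1) ε F) (w : (Fin (n + 1) → ℝ) → ℝ) (hw : Measurable w)
    (hpos : ∀ t, F t ≠ 0 → 0 < t m → ∑ j ∈ univ.erase m, t j ≤ 1 - ε → 0 < w t)
    (hbudget : ∀ s : Fin n → ℝ, (∀ j, 0 ≤ s j) → ∑ j, s j ≤ 1 - ε →
      ∫⁻ u in Ioc (0:ℝ) (1 + ε - ∑ j, s j), ENNReal.ofReal (w (Fin.insertNth m u s))⁻¹ ≤ 1) :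
    ENNReal.ofReal (polymathJ (n + 1) (1 - ε) m F) ≤
      ∫⁻ t, {t : Fin (n + 1) → ℝ | 0 < t m ∧ ∑ j ∈ univ.erase m, t j ≤ 1 - ε}.indicator
        (fun t => ENNReal.ofReal (w t * F t ^ 2)) t := by
  have hFm : Measurable F := hF.measurable
  -- the integrand `G = 1_E · ofReal (w F²)`
  set E : Set (Fin (n + 1) → ℝ) := {t | 0 < t m ∧ ∑ j ∈ univ.erase m, t j ≤ 1 - ε} with hE
  have hEm : MeasurableSet E := measurableSet_active m (1 - ε)
  obtain ⟨G, hG⟩ : ∃ G : (Fin (n + 1) → ℝ) → ℝ≥0∞,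
      G = E.indicator fun t => ENNReal.ofReal (w t * F t ^ 2) := ⟨_, rfl⟩
  have hGm : Measurable G := by
    rw [hG]; exact ((hw.mul (hFm.pow_const 2)).ennreal_ofReal).indicator hEm
  -- splitting off the `m`-th coordinate
  set e := MeasurableEquiv.piFinSuccAbove (fun _ : Fin (n + 1) => ℝ) m with he_def
  have he : MeasurePreserving e.symm volume volume :=
    (volume_preserving_piFinSuccAbove (fun _ : Fin (n + 1) => ℝ) m).symm
  have he_apply : ∀ p : ℝ × (Fin n → ℝ), e.symm p = Fin.insertNth m p.1 p.2 := fun p => by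
    rw [he_def, MeasurableEquiv.piFinSuccAbove_symm_apply]; rfl
  obtain ⟨Λ, hΛ⟩ : ∃ Λ : (Fin n → ℝ) → ℝ≥0∞, Λ = fun s => ∫⁻ u, G (e.symm (u, s)) := ⟨_, rfl⟩
  have hΛm : Measurable Λ := by
    rw [hΛ]; exact (hGm.comp e.symm.measurable).lintegral_prod_left'
  have hswap : ∫⁻ s, Λ s = ∫⁻ t, G t := by
    rw [← he.lintegral_comp_emb e.symm.measurableEmbedding G, Measure.volume_eq_prod, hΛ]
    exact (lintegral_prod_symm (G ∘ e.symm) (hGm.comp e.symm.measurable).aemeasurable).symm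
  -- the fibre bound on the truncated outer simplex
  set S : Set (Fin n → ℝ) := scaledSimplex n (1 - ε) with hS
  have hfib : ∀ s ∈ S,
      ENNReal.ofReal ((∫ u in Ioi (0:ℝ), F (Fin.insertNth m u s)) ^ 2) ≤ Λ s := by
    intro s hs
    have hs0 : ∀ j, 0 ≤ s j := hs.1
    have hs1 : ∑ j, s j ≤ 1 - ε := hs.2
    have hgm : Measurable fun u : ℝ => F (Fin.insertNth m u s) :=
      hFm.comp (continuous_id.finInsertNth m continuous_const).measurable
    have hwm : Measurable fun u : ℝ => w (Fin.insertNth m u s) :=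
      hw.comp (continuous_id.finInsertNth m continuous_const).measurable
    have key := ofReal_sq_setIntegral_Ioi_le (L := 1 + ε - ∑ j, s j) hgm hwm ?_
    · refine key.trans ?_
      calc (∫⁻ u in Ioc (0:ℝ) (1 + ε - ∑ j, s j), ENNReal.ofReal (w (Fin.insertNth m u s))⁻¹) *
            ∫⁻ u in Ioi (0:ℝ), ENNReal.ofReal (w (Fin.insertNth m u s) * F (Fin.insertNth m u s) ^ 2)
          ≤ 1 * ∫⁻ u in Ioi (0:ℝ),
              ENNReal.ofReal (w (Fin.insertNth m u s) * F (Fin.insertNth m u s) ^ 2) :=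
            mul_le_mul' (hbudget s hs0 hs1) le_rfl
        _ = ∫⁻ u, (Ioi (0:ℝ)).indicator (fun u =>
              ENNReal.ofReal (w (Fin.insertNth m u s) * F (Fin.insertNth m u s) ^ 2)) u := by
            rw [one_mul, lintegral_indicator measurableSet_Ioi]
        _ = Λ s := by
            rw [hΛ]
            refine lintegral_congr fun u => ?_
            rw [he_apply, hG]
            dsimp only
            by_cases hu : u ∈ Ioi (0:ℝ)
            · have hmem : (Fin.insertNth m u s : Fin (n + 1) → ℝ) ∈ E := by
                rw [hE, Set.mem_setOf_eq, sum_erase_self_insertNth, Fin.insertNth_apply_same]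
                exact ⟨hu, hs1⟩
              rw [indicator_of_mem hu, indicator_of_mem hmem]
            · have hnot : (Fin.insertNth m u s : Fin (n + 1) → ℝ) ∉ E := by
                rw [hE, Set.mem_setOf_eq, Fin.insertNth_apply_same]
                exact fun h => hu h.1
              rw [indicator_of_notMem hu, indicator_of_notMem hnot]
    · intro u hu hne
      have ht : (Fin.insertNth m u s : Fin (n + 1) → ℝ) ∈ scaledSimplex (n + 1) (1 + ε) :=
        hF.support_subset (Function.mem_support.2 hne)
      obtain ⟨-, -, h3⟩ := (insertNth_mem_scaledSimplex_iff m (1 + ε) u s).1 ht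
      refine ⟨by linarith, hpos _ hne ?_ ?_⟩
      · simpa using hu
      · rw [sum_erase_self_insertNth]; exact hs1
  -- assemble
  calc ENNReal.ofReal (polymathJ (n + 1) (1 - ε) m F)
      ≤ ‖polymathJ (n + 1) (1 - ε) m F‖ₑ := Real.ofReal_le_enorm _
    _ ≤ ∫⁻ s in S, ‖(∫ u in Ioi (0:ℝ), F (Fin.insertNth m u s)) ^ 2‖ₑ := by
        rw [polymathJ_succ_eq]; exact enorm_integral_le_lintegral_enorm _
    _ = ∫⁻ s in S, ENNReal.ofReal ((∫ u in Ioi (0:ℝ), F (Fin.insertNth m u s)) ^ 2) :=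
        lintegral_congr fun s => Real.enorm_eq_ofReal (sq_nonneg _)
    _ ≤ ∫⁻ s in S, Λ s := setLIntegral_mono' (measurableSet_scaledSimplex n _) hfib
    _ ≤ ∫⁻ s, Λ s := setLIntegral_le_lintegral _ _
    _ = ∫⁻ t, G t := hswap
    _ = _ := by rw [hG]

end MkEps

/-! ### Summing over the coordinates -/

/-- For a test function `F` of Theorem 3.12, `F²` is integrable on the whole space (it vanishes off
`(1+ε)·R_k`). [folklore] -/
theorem IsPolymathTestFunction.integrable_sq {k : ℕ} {ε : ℝ} {F : (Fin k → ℝ) → ℝ}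
    (hF : IsPolymathTestFunction k ε F) : Integrable fun t => F t ^ 2 :=
  hF.integrableOn_sq.integrable_of_forall_notMem_eq_zero fun t ht => by
    have : F t = 0 := Function.notMem_support.1 fun h => ht (hF.support_subset h)
    simp [this]

/-- `I(F) = ∫ F²` over the whole space for a test function (it vanishes off the orthant). [folklore] -/
theorem IsPolymathTestFunction.polymathI_eq_integral {k : ℕ} {ε : ℝ} {F : (Fin k → ℝ) → ℝ}
    (hF : IsPolymathTestFunction k ε F) : polymathI k F = ∫ t, F t ^ 2 := by
  refine setIntegral_eq_integral_of_forall_compl_eq_zero fun t ht => ?_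
  have : F t = 0 := by
    by_contra h
    exact ht (hF.support_subset (Function.mem_support.2 h)).1
  simp [this]

open MkEps in
/-- **Polymath 8b Lemma 6.1 for the `ε`-enlarged functional (weighted, with indicators).**  Let `F` be a
test function of Theorem 3.12 on `(1+ε)·R_{n+1}` and `w₀, …, w_n` measurable weights such that, for each `m`,
`w_m > 0` wherever `F ≠ 0`, `t_m > 0`, `∑_{j≠m} t_j ≤ 1-ε`, and every fibre over an outer point `s ≥ 0`,
`∑ s ≤ 1-ε`, has budget `∫_{(0,1+ε-∑s]} du / w_m(s with s_m := u) ≤ 1`.  If moreover POINTWISE on the enlarged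
simplex `∑_m 1[t_m > 0, ∑_{j≠m} t_j ≤ 1-ε] · w_m(t) ≤ M`, then `(∑_m J_{m,1-ε}(F))/I(F) ≤ M`.
(For `ε = 0` and `w_m = 1/G_m` this is the printed Lemma 6.1.) [cite: Polymath8b2014, Lemma 6.1] -/
theorem polymathFunctional_le_of_weights {n : ℕ} {ε M : ℝ} (hM : 0 ≤ M) {F : (Fin (n + 1) → ℝ) → ℝ}
    (hF : IsPolymathTestFunction (n + 1) ε F) (w : Fin (n + 1) → (Fin (n + 1) → ℝ) → ℝ)
    (hw : ∀ m, Measurable (w m))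
    (hpos : ∀ m t, F t ≠ 0 → 0 < t m → ∑ j ∈ univ.erase m, t j ≤ 1 - ε → 0 < w m t)
    (hbudget : ∀ m (s : Fin n → ℝ), (∀ j, 0 ≤ s j) → ∑ j, s j ≤ 1 - ε →
      ∫⁻ u in Ioc (0:ℝ) (1 + ε - ∑ j, s j), ENNReal.ofReal (w m (Fin.insertNth m u s))⁻¹ ≤ 1)
    (hpt : ∀ t : Fin (n + 1) → ℝ, (∀ j, 0 ≤ t j) → ∑ j, t j ≤ 1 + ε →
      ∑ m, (if 0 < t m ∧ ∑ j ∈ univ.erase m, t j ≤ 1 - ε then w m t else 0) ≤ M) :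
    polymathFunctional (n + 1) ε F ≤ M := by
  have hFm : Measurable F := hF.measurable
  unfold polymathFunctional
  rw [div_le_iff₀ hF.polymathI_pos]
  -- each summand in `ℝ≥0∞`
  set E : Fin (n + 1) → Set (Fin (n + 1) → ℝ) :=
    fun m => {t | 0 < t m ∧ ∑ j ∈ univ.erase m, t j ≤ 1 - ε} with hE
  have hJ : ∀ m, ENNReal.ofReal (polymathJ (n + 1) (1 - ε) m F) ≤
      ∫⁻ t, (E m).indicator (fun t => ENNReal.ofReal (w m t * F t ^ 2)) t :=
    fun m => ofReal_polymathJ_le m hF (w m) (hw m) (hpos m) (hbudget m)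
  -- pointwise bound of the summed integrand
  have hpt' : ∀ t, ∑ m, (E m).indicator (fun t => ENNReal.ofReal (w m t * F t ^ 2)) t ≤
      ENNReal.ofReal (M * F t ^ 2) := by
    intro t
    by_cases hFt : F t = 0
    · simp [hFt]
    have ht : t ∈ scaledSimplex (n + 1) (1 + ε) := hF.support_subset (Function.mem_support.2 hFt)
    have hsum : ∑ m, (E m).indicator (fun t => ENNReal.ofReal (w m t * F t ^ 2)) t =
        ENNReal.ofReal (∑ m, (if 0 < t m ∧ ∑ j ∈ univ.erase m, t j ≤ 1 - ε then w m t else 0) *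
          F t ^ 2) := by
      rw [ENNReal.ofReal_sum_of_nonneg]
      · refine Finset.sum_congr rfl fun m _ => ?_
        by_cases hm : 0 < t m ∧ ∑ j ∈ univ.erase m, t j ≤ 1 - ε
        · rw [indicator_of_mem (show t ∈ E m from hm), if_pos hm]
        · rw [indicator_of_notMem (show t ∉ E m from hm), if_neg hm]; simp
      · intro m _
        by_cases hm : 0 < t m ∧ ∑ j ∈ univ.erase m, t j ≤ 1 - ε
        · rw [if_pos hm]; exact mul_nonneg (hpos m t hFt hm.1 hm.2).le (sq_nonneg _)
        · rw [if_neg hm]; simp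
    rw [hsum, ← Finset.sum_mul]
    exact ENNReal.ofReal_le_ofReal (mul_le_mul_of_nonneg_right (hpt t ht.1 ht.2) (sq_nonneg _))
  have hmeas : ∀ m, Measurable fun t => (E m).indicator (fun t => ENNReal.ofReal (w m t * F t ^ 2)) t :=
    fun m => (((hw m).mul (hFm.pow_const 2)).ennreal_ofReal).indicator (measurableSet_active m _)
  have hint : Integrable fun t => M * F t ^ 2 := hF.integrable_sq.const_mul M
  have hmain : ENNReal.ofReal (∑ m, polymathJ (n + 1) (1 - ε) m F) ≤
      ENNReal.ofReal (M * polymathI (n + 1) F) := by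
    calc ENNReal.ofReal (∑ m, polymathJ (n + 1) (1 - ε) m F)
        = ∑ m, ENNReal.ofReal (polymathJ (n + 1) (1 - ε) m F) :=
          ENNReal.ofReal_sum_of_nonneg fun m _ => polymathJ_nonneg _ _ _ _
      _ ≤ ∑ m, ∫⁻ t, (E m).indicator (fun t => ENNReal.ofReal (w m t * F t ^ 2)) t :=
          Finset.sum_le_sum fun m _ => hJ m
      _ = ∫⁻ t, ∑ m, (E m).indicator (fun t => ENNReal.ofReal (w m t * F t ^ 2)) t :=
          (lintegral_finsetSum _ fun m _ => hmeas m).symm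
      _ ≤ ∫⁻ t, ENNReal.ofReal (M * F t ^ 2) := lintegral_mono hpt'
      _ = ENNReal.ofReal (∫ t, M * F t ^ 2) :=
          (ofReal_integral_eq_lintegral_ofReal hint (ae_of_all _ fun t => by positivity)).symm
      _ = ENNReal.ofReal (M * polymathI (n + 1) F) := by
          rw [integral_const_mul, hF.polymathI_eq_integral]
  exact (ENNReal.ofReal_le_ofReal_iff (mul_nonneg hM (polymathI_nonneg _ _))).1 hmain

end Literature.NumberTheory.Sieve
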